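import Mathlib
import HarnessLib
import Summits.HubbardSuperconductivity.HubbardSuperconductivity.Theorems.KLProgrammeKLRegimeEnginePairLadderFlowLemmas

/-!
# Route `KLProgramme` — crux K3, ENGINE child gen 5 (stmt-HubbardSuperconductivity-19918 `KLRegimeEngineV14`), stub `stub_engine_step_values`,
# conjunct (E2-v9) at `1 ≤ n`: the WEIGHTED Duhamel comparison for the within-slice pair-vertex flow — `kltc_riccati_duhamel_weighted`

Cell gate-hubbard-kl, seat hubbard-kl-k3c1-p1 (g5), technique «composed-map remainder propagation».  Continuous twin of
`kltc_multistep_compose` (p497654) and weighted twin of `kllf_duhamel` (p483410, sup form): for entrywise-C¹ curves `Γ` (pair vertex), `b`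
(cumulative pair rungs) on `[0,1]` with `Γ̇ = −Γ·diag ḃ·Γ + X`, an a priori entry bound `|Γ(t)| ≤ m`, rung rate `Σ_a‖ḃ(t)_a‖ ≤ β`, tail profile
`‖b(1)_a − b(t)_a‖ ≤ ρ_a` and `(3/2)m·Σρ ≤ 1/3`, the one-slice resummation `F_{b(1)−b(0)}(Γ(0)) = Γ(0)·N` satisfies, ENTRYWISE,
`‖Γ(1) − Γ(0)·N‖(x,y) ≤ I(x,y) + (3/2)(3/2 m)·Σ_c I(x,c)ρ_c + (3/2)m·Σ_a ρ_a I(a,y) + (9/4)m(3/2 m)·Σ_aΣ_c ρ_a I(a,c)ρ_c`, `I = ∫₀¹|X(t)|dt`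
— the weighted four-term form that `kltc_fourTerm_shaped_le` / `klam_phGain3_angular_le` turn into the (E2-v9) budget line (the sup form is
useless at deep `n`: the crossed-channel source is ungained at forward configurations, E2-DRIVE).  Proof: fine partitions `t_i = i/N`;
`kltc_multistep_compose` with the exact sub-step errors; the Riccati discretisation error `(3/2)m³σ_i²` (`kltc_resum_second_order_le`) and the
Taylor error (uniform continuity of `(s,t) ↦ Γ(s)·diag ḃ(t)·Γ(s)` on `[0,1]²`) both sum to `O(1/N)`; `N → ∞`.  This is the bridge of the
CONTINUOUS (E2) organisation (HOME/hubbard-kl-k3c1-p1/E2-CONTINUOUS-ROUTE.md, evidence #24 on 19918): Salmhofer's RGE for the Wick-ordered action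
is exactly quadratic (`GrassmannPolchinskiEquation`), its pair-label 4-leg component is this Riccati equation with `X` = two-vertex non-ladder
terms.  Real analysis + the landed algebra; nothing about the model is asserted.  0 kit.
-/

noncomputable section

namespace Summit.HubbardSuperconductivity.HubbardSuperconductivity.Theorems.KLRegimeSplit

set_option linter.dupNamespace false -- summit = problem name (single-conjunct summit), D-0017

open Finset Matrix Set Literature.MathematicalPhysics.QuantumLattice Literature.Probability.LatticeModels
open Summit.HubbardSuperconductivity.HubbardSuperconductivity.Theorems.KLProgrammeCooperResummation

section Generic

variable {ι : Type*} [Fintype ι] [DecidableEq ι] [Nonempty ι]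

set_option maxHeartbeats 400000 in -- one long real-analysis proof (partition limit); split lemmas above
/-- **Weighted Duhamel comparison for the pair-vertex flow within one slice.**  `Γ, Γ̇, X : ℝ → Matrix ι ι ℂ`, `b, ḃ : ℝ → ι → ℂ` with, on
`[0,1]`: entrywise derivatives `HasDerivAt (Γ · x y) (Γ̇ t x y) t`, `HasDerivAt (b · a) (ḃ t a) t`, continuous `Γ̇`, `ḃ`; the flow equation
`Γ̇(t) = −Γ(t)·diag ḃ(t)·Γ(t) + X(t)`; a priori `|Γ(t)| ≤ m`; rung rate `Σ_a‖ḃ(t)_a‖ ≤ β`; tail profile `‖b(1)_a − b(t)_a‖ ≤ ρ_a`; smallness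
`(3/2)m·Σρ ≤ 1/3`.  THEN `1 + diag(b(1) − b(0))·Γ(0)` has a two-sided inverse `N` and, with `I(x,y) := ∫₀¹ ‖X(t)(x,y)‖dt`,
`‖Γ(1) − Γ(0)·N‖(x,y) ≤ I(x,y) + (3/2)(3/2 m)·Σ_c I(x,c)ρ_c + (3/2)m·Σ_a ρ_a I(a,y) + (9/4)m(3/2 m)·Σ_aΣ_c ρ_a I(a,c)ρ_c`. -/
theorem kltc_riccati_duhamel_weighted (Γ Γ' X : ℝ → Matrix ι ι ℂ) (b b' : ℝ → ι → ℂ) (ρ : ι → ℝ) {m β : ℝ} (hm : 0 ≤ m)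
    (hΓ : ∀ t ∈ Icc (0 : ℝ) 1, ∀ x y, HasDerivAt (fun s => Γ s x y) (Γ' t x y) t)
    (hb : ∀ t ∈ Icc (0 : ℝ) 1, ∀ a, HasDerivAt (fun s => b s a) (b' t a) t)
    (hΓ'c : ∀ x y, ContinuousOn (fun t => Γ' t x y) (Icc 0 1)) (hb'c : ∀ a, ContinuousOn (fun t => b' t a) (Icc 0 1))
    (hX : ∀ t ∈ Icc (0 : ℝ) 1, X t = Γ' t + Γ t * diagonal (b' t) * Γ t)
    (hΓm : ∀ t ∈ Icc (0 : ℝ) 1, ∀ x y, ‖Γ t x y‖ ≤ m) (hβ : ∀ t ∈ Icc (0 : ℝ) 1, ∑ a, ‖b' t a‖ ≤ β)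
    (hρ : ∀ t ∈ Icc (0 : ℝ) 1, ∀ a, ‖b 1 a - b t a‖ ≤ ρ a) (hsm : 3 / 2 * m * ∑ a, ρ a ≤ 1 / 3) :
    ∃ N : Matrix ι ι ℂ, (1 + diagonal (b 1 - b 0) * Γ 0) * N = 1 ∧ N * (1 + diagonal (b 1 - b 0) * Γ 0) = 1 ∧
      ∀ x y, ‖Γ 1 x y - (Γ 0 * N) x y‖ ≤ (∫ t in (0 : ℝ)..1, ‖X t x y‖) +
        3 / 2 * (3 / 2 * m) * ∑ c, (∫ t in (0 : ℝ)..1, ‖X t x c‖) * ρ c + 3 / 2 * m * ∑ a, ρ a * (∫ t in (0 : ℝ)..1, ‖X t a y‖) +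
          9 / 4 * m * (3 / 2 * m) * ∑ a, ∑ c, ρ a * (∫ t in (0 : ℝ)..1, ‖X t a c‖) * ρ c := by
  -- masses
  have h01 : (0 : ℝ) ∈ Icc (0 : ℝ) 1 := ⟨le_rfl, zero_le_one⟩
  have h11 : (1 : ℝ) ∈ Icc (0 : ℝ) 1 := ⟨zero_le_one, le_rfl⟩
  have hρ0 : ∀ a, 0 ≤ ρ a := fun a => by
    have h := hρ 1 h11 a
    rw [sub_self, norm_zero] at h
    exact h
  set Z : ℝ := ∑ a, ρ a with hZ_def
  have hZ0 : 0 ≤ Z := sum_nonneg fun a _ => hρ0 a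
  have hmZ : m * Z ≤ 1 / 3 := (mul_le_mul_of_nonneg_right (by linarith : m ≤ 3 / 2 * m) hZ0).trans hsm
  have hβ0 : 0 ≤ β := (sum_nonneg fun a _ => norm_nonneg _).trans (hβ 0 h01)
  -- the inverse `N`
  have hWm : m * ∑ a, ‖(b 1 - b 0) a‖ ≤ 1 / 3 :=
    (mul_le_mul_of_nonneg_left (sum_le_sum fun a _ => by rw [Pi.sub_apply]; exact hρ 0 h01 a) hm).trans hmZ
  obtain ⟨N, _, hN1, hN2, -, -, -, -, -, -, -, -⟩ := klcrs_single_slice (b 1 - b 0) hm (Γ 0) (hΓm 0 h01) hWm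
  refine ⟨N, hN1, hN2, fun x₀ y₀ => ?_⟩
  -- continuity of `Γ` and `X`
  have hΓc : ∀ x y, ContinuousOn (fun t => Γ t x y) (Icc 0 1) := fun x y t ht =>
    (hΓ t ht x y).continuousAt.continuousWithinAt
  have hXc : ∀ x y, ContinuousOn (fun t => X t x y) (Icc 0 1) := by
    intro x y
    have hGd : ContinuousOn (fun t => (Γ t * diagonal (b' t) * Γ t) x y) (Icc 0 1) := by
      have h : ∀ t, (Γ t * diagonal (b' t) * Γ t) x y = ∑ a, Γ t x a * b' t a * Γ t a y :=
        fun t => klli_mul_diag_mul_apply _ _ _ _ _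
      simp_rw [h]
      exact continuousOn_finsetSum _ fun a _ => ((hΓc x a).mul (hb'c a)).mul (hΓc a y)
    have h : ∀ t ∈ Icc (0 : ℝ) 1, X t x y = Γ' t x y + (Γ t * diagonal (b' t) * Γ t) x y := fun t ht => by
      rw [hX t ht, Matrix.add_apply]
    exact ((hΓ'c x y).add hGd).congr h
  -- the four-term operator norm factor and the tolerance
  set K : ℝ := 1 + 3 / 2 * (3 / 2 * m) * Z + 3 / 2 * m * Z + 9 / 4 * m * (3 / 2 * m) * (Z * Z) with hK_def
  have hK1 : 1 ≤ K := by
    have h1 : 0 ≤ 3 / 2 * (3 / 2 * m) * Z := by positivity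
    have h2 : 0 ≤ 3 / 2 * m * Z := by positivity
    have h3 : 0 ≤ 9 / 4 * m * (3 / 2 * m) * (Z * Z) := by positivity
    rw [hK_def]; linarith
  have hK0 : 0 < K := by linarith
  set I : ι → ι → ℝ := fun x y => ∫ t in (0 : ℝ)..1, ‖X t x y‖ with hI_def
  refine le_of_forall_pos_le_add fun ε hε => ?_
  set η : ℝ := ε / K with hη_def
  have hη : 0 < η := div_pos hε hK0
  set B : ℝ := Fintype.card ι * β with hB_def
  have hB0 : 0 ≤ B := by positivity
  -- partition helpers
  have hmem : ∀ {Np : ℕ}, 0 < Np → ∀ i, i ≤ Np → ((i : ℕ) : ℝ) / Np ∈ Icc (0 : ℝ) 1 := by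
    intro Np hNp i hi
    have hNpR : (0 : ℝ) < Np := by exact_mod_cast hNp
    exact ⟨by positivity, by rw [div_le_one hNpR]; exact_mod_cast hi⟩
  have hstep : ∀ {Np : ℕ}, 0 < Np → ∀ i : ℕ, (((i + 1 : ℕ) : ℝ) / Np) - ((i : ℕ) : ℝ) / Np = 1 / Np := by
    intro Np hNp i
    have hNpR : (Np : ℝ) ≠ 0 := by exact_mod_cast hNp.ne'
    field_simp; push_cast; ring
  have hmono : ∀ {Np : ℕ}, 0 < Np → ∀ i : ℕ, ((i : ℕ) : ℝ) / Np ≤ ((i + 1 : ℕ) : ℝ) / Np := by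
    intro Np hNp i
    have h1 := hstep hNp i
    have hNpR : (0 : ℝ) < Np := by exact_mod_cast hNp
    have h2 : (0 : ℝ) < 1 / Np := by positivity
    linarith
  -- (P1): eventually every rung increment is below the tail profile
  have hP1 : ∀ a, ∀ᶠ Np : ℕ in Filter.atTop, 0 < Np →
      ∀ i, i < Np → ‖b (((i + 1 : ℕ) : ℝ) / Np) a - b (((i : ℕ) : ℝ) / Np) a‖ ≤ ρ a := by
    intro a
    rcases (hρ0 a).eq_or_lt with hz | hpos
    · refine Filter.Eventually.of_forall fun Np hNp i hi => ?_
      have hc : ∀ t ∈ Icc (0 : ℝ) 1, b t a = b 1 a := fun t ht => by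
        have h := hρ t ht a
        rw [← hz] at h
        exact (eq_of_sub_eq_zero (norm_le_zero_iff.1 h)).symm
      rw [hc _ (hmem hNp (i + 1) (by omega)), hc _ (hmem hNp i hi.le), sub_self, norm_zero, ← hz]
    · obtain ⟨N₀, hN₀⟩ := exists_nat_gt (β / ρ a)
      refine Filter.eventually_atTop.2 ⟨N₀, fun Np hNp hNp0 i hi => ?_⟩
      have hNpR : (0 : ℝ) < Np := by exact_mod_cast hNp0
      calc ‖b (((i + 1 : ℕ) : ℝ) / Np) a - b (((i : ℕ) : ℝ) / Np) a‖ ≤ β * ((((i + 1 : ℕ) : ℝ) / Np) - ((i : ℕ) : ℝ) / Np) :=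
            (kltc_rung_increment_le b b' hb hb'c hβ (hmem hNp0 i hi.le) (hmem hNp0 (i + 1) (by omega)) (hmono hNp0 i) a).2
        _ = β / Np := by rw [hstep hNp0 i]; ring
        _ ≤ ρ a := by
            rw [div_le_iff₀ hNpR]
            have h1 : β / ρ a * ρ a = β := div_mul_cancel₀ β hpos.ne'
            have h2 : (N₀ : ℝ) ≤ Np := by exact_mod_cast hNp
            nlinarith [hN₀, hρ0 a]
  -- (P2): eventually the summed sub-step errors are below `I + η`
  have hP2 : ∀ x y, ∀ᶠ Np : ℕ in Filter.atTop, 0 < Np →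
      ∑ i ∈ range Np, ‖Γ (((i + 1 : ℕ) : ℝ) / Np) x y -
        (Γ (((i : ℕ) : ℝ) / Np) * (1 + diagonal (b (((i + 1 : ℕ) : ℝ) / Np) - b (((i : ℕ) : ℝ) / Np)) * Γ (((i : ℕ) : ℝ) / Np))⁻¹) x y‖ ≤
      I x y + η := by
    intro x y
    -- uniform continuity of the frozen-vertex bubble term on `[0,1]²`
    have hG2c : ContinuousOn (fun p : ℝ × ℝ => (Γ p.1 * diagonal (b' p.2) * Γ p.1) x y) (Icc (0 : ℝ) 1 ×ˢ Icc (0 : ℝ) 1) := by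
      have h : ∀ p : ℝ × ℝ, (Γ p.1 * diagonal (b' p.2) * Γ p.1) x y = ∑ a, Γ p.1 x a * b' p.2 a * Γ p.1 a y :=
        fun p => klli_mul_diag_mul_apply _ _ _ _ _
      simp_rw [h]
      refine continuousOn_finsetSum _ fun a _ => ?_
      have h1 : ContinuousOn (fun p : ℝ × ℝ => Γ p.1 x a) (Icc (0 : ℝ) 1 ×ˢ Icc (0 : ℝ) 1) :=
        (hΓc x a).comp continuous_fst.continuousOn fun p hp => (mem_prod.1 hp).1
      have h2 : ContinuousOn (fun p : ℝ × ℝ => b' p.2 a) (Icc (0 : ℝ) 1 ×ˢ Icc (0 : ℝ) 1) :=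
        (hb'c a).comp continuous_snd.continuousOn fun p hp => (mem_prod.1 hp).2
      have h3 : ContinuousOn (fun p : ℝ × ℝ => Γ p.1 a y) (Icc (0 : ℝ) 1 ×ˢ Icc (0 : ℝ) 1) :=
        (hΓc a y).comp continuous_fst.continuousOn fun p hp => (mem_prod.1 hp).1
      exact (h1.mul h2).mul h3
    have hGuc := (isCompact_Icc.prod isCompact_Icc).uniformContinuousOn_of_continuous hG2c
    obtain ⟨δ, hδ, hGδ⟩ := Metric.uniformContinuousOn_iff.1 hGuc (η / 2) (by positivity)
    obtain ⟨N₁, hN₁⟩ := exists_nat_gt (1 / δ)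
    obtain ⟨N₂, hN₂⟩ := exists_nat_gt (3 * m ^ 3 * B ^ 2 / η)
    obtain ⟨N₃, hN₃⟩ := exists_nat_gt (3 * m * B)
    refine Filter.eventually_atTop.2 ⟨max N₁ (max N₂ N₃), fun Np hNp hNp0 => ?_⟩
    have hNp1 : (N₁ : ℝ) ≤ Np := by exact_mod_cast (le_max_left _ _).trans hNp
    have hNp2 : (N₂ : ℝ) ≤ Np := by exact_mod_cast ((le_max_left _ _).trans (le_max_right _ _)).trans hNp
    have hNp3 : (N₃ : ℝ) ≤ Np := by exact_mod_cast ((le_max_right _ _).trans (le_max_right _ _)).trans hNp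
    have hNpR : (0 : ℝ) < Np := by exact_mod_cast hNp0
    have hinvδ : 1 / (Np : ℝ) < δ := by
      rw [div_lt_iff₀ hNpR]
      have h1 : 1 / δ * δ = 1 := by field_simp
      nlinarith [hN₁, hδ]
    -- per-step bound
    have hstep_bd : ∀ i, i < Np → ‖Γ (((i + 1 : ℕ) : ℝ) / Np) x y -
        (Γ (((i : ℕ) : ℝ) / Np) * (1 + diagonal (b (((i + 1 : ℕ) : ℝ) / Np) - b (((i : ℕ) : ℝ) / Np)) * Γ (((i : ℕ) : ℝ) / Np))⁻¹) x y‖ ≤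
        (∫ t in (((i : ℕ) : ℝ) / Np)..(((i + 1 : ℕ) : ℝ) / Np), ‖X t x y‖) + η / 2 * (1 / Np) + 3 / 2 * m ^ 3 * (B * (1 / Np)) ^ 2 := by
      intro i hi
      have hs := hmem hNp0 i hi.le
      have hu := hmem hNp0 (i + 1) (by omega)
      have hsu := hmono hNp0 i
      -- mass of the increment
      have hσ : ∑ a, ‖(b (((i + 1 : ℕ) : ℝ) / Np) - b (((i : ℕ) : ℝ) / Np)) a‖ ≤ B * (1 / Np) := by
        calc ∑ a, ‖(b (((i + 1 : ℕ) : ℝ) / Np) - b (((i : ℕ) : ℝ) / Np)) a‖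
            ≤ ∑ _a : ι, β * ((((i + 1 : ℕ) : ℝ) / Np) - ((i : ℕ) : ℝ) / Np) :=
              sum_le_sum fun a _ => by rw [Pi.sub_apply]; exact (kltc_rung_increment_le b b' hb hb'c hβ hs hu hsu a).2
          _ = B * (1 / Np) := by rw [sum_const, card_univ, nsmul_eq_mul, hstep hNp0 i, hB_def]; ring
      have hσm : m * ∑ a, ‖(b (((i + 1 : ℕ) : ℝ) / Np) - b (((i : ℕ) : ℝ) / Np)) a‖ ≤ 1 / 3 := by
        refine (mul_le_mul_of_nonneg_left hσ hm).trans ?_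
        rw [show m * (B * (1 / Np)) = m * B / Np by ring, div_le_iff₀ hNpR]
        nlinarith [hN₃, hNp3]
      obtain ⟨Nw, _, hNw1, -, -, -, -, -, -, -, -, -⟩ := klcrs_single_slice _ hm _ (hΓm _ hs) hσm
      have hinv := Matrix.mul_nonsing_inv _ (Matrix.isUnit_det_of_right_inverse hNw1)
      have hB_i := kltc_resum_second_order_le _ _ _ hm (hΓm _ hs) hσm hinv x y
      have hA_i := kltc_flow_taylor_le Γ Γ' X b b' hΓ hb hΓ'c hb'c hX hs hu hsu x y (ω := η / 2) (fun t ht => by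
        have ht' : t ∈ Icc (0 : ℝ) 1 := ⟨hs.1.trans ht.1, ht.2.trans hu.2⟩
        have hdist : dist ((((i : ℕ) : ℝ) / Np), t) (t, t) < δ := by
          rw [Prod.dist_eq, dist_self, max_eq_left dist_nonneg, Real.dist_eq, abs_sub_comm,
            abs_of_nonneg (sub_nonneg.2 ht.1)]
          have h1 : t - ((i : ℕ) : ℝ) / Np ≤ 1 / Np := by rw [← hstep hNp0 i]; linarith [ht.2]
          exact h1.trans_lt hinvδ
        have h := hGδ _ (mk_mem_prod hs ht') _ (mk_mem_prod ht' ht') hdist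
        rw [dist_eq_norm] at h
        exact h.le)
      rw [hstep hNp0 i] at hA_i
      have hsplit : Γ (((i + 1 : ℕ) : ℝ) / Np) x y -
          (Γ (((i : ℕ) : ℝ) / Np) * (1 + diagonal (b (((i + 1 : ℕ) : ℝ) / Np) - b (((i : ℕ) : ℝ) / Np)) * Γ (((i : ℕ) : ℝ) / Np))⁻¹) x y =
          (Γ (((i + 1 : ℕ) : ℝ) / Np) x y - Γ (((i : ℕ) : ℝ) / Np) x y +
            (Γ (((i : ℕ) : ℝ) / Np) * diagonal (b (((i + 1 : ℕ) : ℝ) / Np) - b (((i : ℕ) : ℝ) / Np)) * Γ (((i : ℕ) : ℝ) / Np)) x y) -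
          ((Γ (((i : ℕ) : ℝ) / Np) * (1 + diagonal (b (((i + 1 : ℕ) : ℝ) / Np) - b (((i : ℕ) : ℝ) / Np)) * Γ (((i : ℕ) : ℝ) / Np))⁻¹) x y -
            Γ (((i : ℕ) : ℝ) / Np) x y +
            (Γ (((i : ℕ) : ℝ) / Np) * diagonal (b (((i + 1 : ℕ) : ℝ) / Np) - b (((i : ℕ) : ℝ) / Np)) * Γ (((i : ℕ) : ℝ) / Np)) x y) := by
        ring
      rw [hsplit]
      refine (norm_sub_le _ _).trans ?_
      have hB' : 3 / 2 * m ^ 3 * (∑ a, ‖(b (((i + 1 : ℕ) : ℝ) / Np) - b (((i : ℕ) : ℝ) / Np)) a‖) ^ 2 ≤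
          3 / 2 * m ^ 3 * (B * (1 / Np)) ^ 2 :=
        mul_le_mul_of_nonneg_left (pow_le_pow_left₀ (sum_nonneg fun a _ => norm_nonneg _) hσ 2) (by positivity)
      linarith [hA_i, hB_i, hB']
    -- sum over the partition
    have hsumX : ∑ i ∈ range Np, ∫ t in (((i : ℕ) : ℝ) / Np)..(((i + 1 : ℕ) : ℝ) / Np), ‖X t x y‖ = I x y := by
      rw [hI_def]; dsimp only
      have h := intervalIntegral.sum_integral_adjacent_intervals (f := fun t => ‖X t x y‖) (μ := MeasureTheory.volume)
        (a := fun k => ((k : ℕ) : ℝ) / Np) (n := Np) fun k hk => by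
          have hsub : uIcc (((k : ℕ) : ℝ) / Np) (((k + 1 : ℕ) : ℝ) / Np) ⊆ Icc (0 : ℝ) 1 := by
            rw [uIcc_of_le (hmono hNp0 k)]; exact Icc_subset_Icc (hmem hNp0 k hk.le).1 (hmem hNp0 (k + 1) (by omega)).2
          exact (((hXc x y).mono hsub).intervalIntegrable).norm
      rw [h]
      have h0 : ((0 : ℕ) : ℝ) / (Np : ℝ) = 0 := by simp
      have hN : ((Np : ℕ) : ℝ) / (Np : ℝ) = 1 := div_self hNpR.ne'
      rw [h0, hN]
    calc ∑ i ∈ range Np, ‖Γ (((i + 1 : ℕ) : ℝ) / Np) x y -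
          (Γ (((i : ℕ) : ℝ) / Np) * (1 + diagonal (b (((i + 1 : ℕ) : ℝ) / Np) - b (((i : ℕ) : ℝ) / Np)) * Γ (((i : ℕ) : ℝ) / Np))⁻¹) x y‖
        ≤ ∑ i ∈ range Np, ((∫ t in (((i : ℕ) : ℝ) / Np)..(((i + 1 : ℕ) : ℝ) / Np), ‖X t x y‖) + η / 2 * (1 / Np) +
            3 / 2 * m ^ 3 * (B * (1 / Np)) ^ 2) := sum_le_sum fun i hi => hstep_bd i (mem_range.1 hi)
      _ = I x y + η / 2 + 3 / 2 * m ^ 3 * B ^ 2 / Np := by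
          rw [sum_add_distrib, sum_add_distrib, hsumX, sum_const, sum_const, card_range, nsmul_eq_mul, nsmul_eq_mul]
          field_simp
      _ ≤ I x y + η := by
          have h : 3 / 2 * m ^ 3 * B ^ 2 / Np ≤ η / 2 := by
            rw [div_le_iff₀ hNpR]
            have : 3 * m ^ 3 * B ^ 2 / η * η = 3 * m ^ 3 * B ^ 2 := div_mul_cancel₀ _ hη.ne'
            nlinarith [hN₂, hNp2, hη]
          linarith
  -- pick one partition size
  obtain ⟨Np, hNp0, hNp1, hNp2⟩ := ((Filter.eventually_gt_atTop 0).and ((Filter.eventually_all.2 hP1).and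
    (Filter.eventually_all.2 fun x => Filter.eventually_all.2 (hP2 x)))).exists
  have hNpR : (0 : ℝ) < Np := by exact_mod_cast hNp0
  -- the partition data for `kltc_multistep_compose`
  set tp : ℕ → ℝ := fun i => ((i : ℕ) : ℝ) / Np with htp_def
  have htp0 : tp 0 = 0 := by simp [htp_def]
  have htpN : tp Np = 1 := by rw [htp_def]; exact div_self hNpR.ne'
  set Γs : ℕ → Matrix ι ι ℂ := fun i => Γ (tp i) with hΓs_def
  set ws : ℕ → ι → ℂ := fun i => b (tp (i + 1)) - b (tp i) with hws_def
  set Nws : ℕ → Matrix ι ι ℂ := fun i => (1 + diagonal (ws i) * Γs i)⁻¹ with hNws_def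
  set Es : ℕ → ι → ι → ℝ := fun i x y => ‖Γs (i + 1) x y - (Γs i * Nws i) x y‖ with hEs_def
  have hΓsm : ∀ i, i ≤ Np → ∀ x y, ‖Γs i x y‖ ≤ m := fun i hi x y => hΓm _ (hmem hNp0 i hi) x y
  have hwsρ : ∀ i, i < Np → ∀ a, ‖ws i a‖ ≤ ρ a := fun i hi a => hNp1 a hNp0 i hi
  have htele : ∀ i a, i ≤ Np → ∑ j ∈ Ico i Np, ws j a = b 1 a - b (tp i) a := by
    intro i a hi
    rw [Finset.sum_Ico_eq_sum_range]
    have h := Finset.sum_range_sub (fun k => b (tp (i + k)) a) (Np - i)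
    simp only [Nat.add_sub_cancel' hi, Nat.add_zero, htpN] at h
    simp only [hws_def, Pi.sub_apply]
    exact h
  have hWs : ∀ i a, ‖∑ j ∈ Ico i Np, ws j a‖ ≤ ρ a := by
    intro i a
    by_cases hi : i ≤ Np
    · rw [htele i a hi]; exact hρ _ (hmem hNp0 i hi) a
    · rw [Nat.not_le] at hi
      rw [Finset.Ico_eq_empty (by omega), sum_empty, norm_zero]; exact hρ0 a
  have hNws : ∀ i, i < Np → (1 + diagonal (ws i) * Γs i) * Nws i = 1 := by
    intro i hi
    have hσm : m * ∑ a, ‖ws i a‖ ≤ 1 / 3 := (mul_le_mul_of_nonneg_left (sum_le_sum fun a _ => hwsρ i hi a) hm).trans hmZ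
    obtain ⟨Nw, _, hNw1, -, -, -, -, -, -, -, -, -⟩ := klcrs_single_slice (ws i) hm (Γs i) (hΓsm i hi.le) hσm
    exact Matrix.mul_nonsing_inv _ (Matrix.isUnit_det_of_right_inverse hNw1)
  obtain ⟨Nt, hNt1, -, hbd⟩ := kltc_multistep_compose Np Γs Nws ws Es ρ hm hΓsm hwsρ hWs hNws (fun i _ x y => le_rfl) hsm
  -- identify `Nt = N`
  have hsumw : (fun a => ∑ j ∈ range Np, ws j a) = b 1 - b 0 := by
    funext a
    have h := htele 0 a (Nat.zero_le _)
    rw [Nat.Ico_zero_eq_range, htp0] at h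
    rw [h, Pi.sub_apply]
  have hΓs0 : Γs 0 = Γ 0 := by show Γ (tp 0) = Γ 0; rw [htp0]
  have hΓsN : Γs Np = Γ 1 := by show Γ (tp Np) = Γ 1; rw [htpN]
  rw [hsumw, hΓs0] at hNt1
  have hNtN : Nt = N := by
    calc Nt = N * (1 + diagonal (b 1 - b 0) * Γ 0) * Nt := by rw [hN2, one_mul]
      _ = N := by rw [mul_assoc, hNt1, mul_one]
  have hbd' : ‖Γ 1 x₀ y₀ - (Γ 0 * N) x₀ y₀‖ ≤ ∑ i ∈ range Np, (Es i x₀ y₀ + 3 / 2 * (3 / 2 * m) * ∑ c, Es i x₀ c * ρ c +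
      3 / 2 * m * ∑ a, ρ a * Es i a y₀ + 9 / 4 * m * (3 / 2 * m) * ∑ a, ∑ c, ρ a * Es i a c * ρ c) := by
    have h := hbd x₀ y₀
    rw [hΓsN, hΓs0, hNtN] at h
    exact h
  -- the summed errors are at most `I + η` entrywise
  have hS : ∀ x y, ∑ i ∈ range Np, Es i x y ≤ I x y + η := fun x y => hNp2 x y hNp0
  refine hbd'.trans ?_
  rw [sum_add_distrib, sum_add_distrib, sum_add_distrib, ← mul_sum, ← mul_sum, ← mul_sum]
  have e1 := hS x₀ y₀
  have e2 : ∑ i ∈ range Np, ∑ c, Es i x₀ c * ρ c ≤ ∑ c, (I x₀ c + η) * ρ c := by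
    rw [sum_comm]
    exact sum_le_sum fun c _ => by rw [← sum_mul]; exact mul_le_mul_of_nonneg_right (hS x₀ c) (hρ0 c)
  have e3 : ∑ i ∈ range Np, ∑ a, ρ a * Es i a y₀ ≤ ∑ a, ρ a * (I a y₀ + η) := by
    rw [sum_comm]
    exact sum_le_sum fun a _ => by rw [← mul_sum]; exact mul_le_mul_of_nonneg_left (hS a y₀) (hρ0 a)
  have e4 : ∑ i ∈ range Np, ∑ a, ∑ c, ρ a * Es i a c * ρ c ≤ ∑ a, ∑ c, ρ a * (I a c + η) * ρ c := by
    rw [sum_comm]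
    refine sum_le_sum fun a _ => ?_
    rw [sum_comm]
    refine sum_le_sum fun c _ => ?_
    have : ∑ i ∈ range Np, ρ a * Es i a c * ρ c = ρ a * (∑ i ∈ range Np, Es i a c) * ρ c := by rw [mul_sum, sum_mul]
    rw [this]
    exact mul_le_mul_of_nonneg_right (mul_le_mul_of_nonneg_left (hS a c) (hρ0 a)) (hρ0 c)
  have f2 := mul_le_mul_of_nonneg_left e2 (by positivity : (0 : ℝ) ≤ 3 / 2 * (3 / 2 * m))
  have f3 := mul_le_mul_of_nonneg_left e3 (by positivity : (0 : ℝ) ≤ 3 / 2 * m)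
  have f4 := mul_le_mul_of_nonneg_left e4 (by positivity : (0 : ℝ) ≤ 9 / 4 * m * (3 / 2 * m))
  have hsplit2 : ∑ c, (I x₀ c + η) * ρ c = ∑ c, I x₀ c * ρ c + η * Z := by
    rw [hZ_def, mul_sum, ← sum_add_distrib]; exact sum_congr rfl fun c _ => by ring
  have hsplit3 : ∑ a, ρ a * (I a y₀ + η) = ∑ a, ρ a * I a y₀ + η * Z := by
    rw [hZ_def, mul_sum, ← sum_add_distrib]; exact sum_congr rfl fun a _ => by ring
  have hsplit4 : ∑ a, ∑ c, ρ a * (I a c + η) * ρ c = ∑ a, ∑ c, ρ a * I a c * ρ c + η * (Z * Z) := by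
    rw [hZ_def, sum_mul_sum, mul_sum, ← sum_add_distrib]
    refine sum_congr rfl fun a _ => ?_
    rw [mul_sum, ← sum_add_distrib]
    exact sum_congr rfl fun c _ => by ring
  rw [hsplit2] at f2; rw [hsplit3] at f3; rw [hsplit4] at f4
  have hηK : η * K = ε := by rw [hη_def]; field_simp
  have hfin : η + 3 / 2 * (3 / 2 * m) * (η * Z) + 3 / 2 * m * (η * Z) + 9 / 4 * m * (3 / 2 * m) * (η * (Z * Z)) = ε := by
    rw [← hηK, hK_def]; ring
  simp only [hI_def] at e1 f2 f3 f4 ⊢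
  linarith

end Generic

end Summit.HubbardSuperconductivity.HubbardSuperconductivity.Theorems.KLRegimeSplit

end
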